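import Summits.Ventures.Crystal3D.Theorems.StickyWulffConstantCoaxialWallLawJammedMono
import HarnessLib

/-!
# Stub closer `stub_jammedOneSmall` of the registered skeleton 'CoaxialWallLawCertificates' v5 (crux `CoaxialWallLaw`, stmt-Ventures-19481)

HONEST FRAMING. Venture `Summits/Ventures/Crystal3D` (cell `crystal3d-full`); `--supports` the crux `CoaxialWallLaw` (stmt-Ventures-19481,
`route-Ventures-StickyWulffConstant`), registered line 'CoaxialWallLawCertificates' v5 (cf-p1 g32, 12:58Z; twelve stubs, composition
`coaxialWallLaw_of_lensCertificates_jammed_split`).  Closes the stub `stub_jammedOneSmall : TailResidue.JammedOneSmall (2√6) 3` BY NAME with the tree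
theorem `TailResidue.jammedOneSmall_twoSqrtSix` (`…JammedMono`: a U-A1 payer window — a coaxial-module pattern plus one jammed ball of `≤ 3` contacts, off-site —
is always MONO-MODULE, so the stub's hypothesis `¬ MonoModuleAt` is contradicted; no census, no kissing facts).  Standard axioms.  Nothing new is proved here.
-/

namespace Summit.Ventures.Crystal3D.Cruxes.CoaxialWallLaw.Certificates

open Summit.Ventures.Crystal3D.Theorems

/-- **Stub closer**: `TailResidue.JammedOneSmall (2√6) 3` — U-A1 windows are mono-module (tree theorem `TailResidue.jammedOneSmall_twoSqrtSix`). -/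
theorem stub_jammedOneSmall : TailResidue.JammedOneSmall (2 * Real.sqrt 6) 3 :=
  TailResidue.jammedOneSmall_twoSqrtSix

end Summit.Ventures.Crystal3D.Cruxes.CoaxialWallLaw.Certificates
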